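import Summits.QuantumFields.YangMills.Theorems.UnitScaleTiltProp7TorusGreenKernelRows
import Summits.QuantumFields.YangMills.Theorems.UnitScaleTiltProp7GreenKernelSiteFree
import Summits.QuantumFields.YangMills.Theorems.UnitScaleTiltProp7PinnedKernelGeometry
import HarnessLib

/-!
# Route `UnitScaleTilt`, crux K1 «MinimiserStabilityRegPr» (stmt-QuantumFields-19200), route-R E′ path (α′), (E1-b) at the CURVED background, (A-cov) gen-0, FILE «DIPOLE POTENTIAL ROWS»:
# THE FLAT TORUS DIPOLE POTENTIAL `V := G_f(b + e_μ, ·) − G_f(b, ·)` ON `Site P 0` (`d = 3`) WITH ITS FIVE RADIAL ROWS AROUND THE POLE `b` — `Δ²V = δ_{b+e_μ} − δ_b` EXACTLY, `|V| ≤ C`,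
# `|∂^±V| ≤ C∕(1∨r)`, `|ΔV| ≤ C∕(1∨r)²`, `|∂^±ΔV| ≤ C∕(1∨r)³` (`r = tdist(·, b)`, ONE absolute `C`) — the scalar `ψ` (before cutoff) of the gen-0 transplant `V⁰ = ψ•R(Fr)Y`

Cell `ym3-torus`, width seat `ym3-torus-px22` (gen 3), ★routeR-w3 g6 WORD (13) «(A-cov) INSTANTIATION» (gen-0 numbers = this seat, routeR-w6 g6 23:16:58Z).  The rows are READINGS of ★w8 g7's kernel kit
✓p674845 `Prop7TorusGreenKernelRows` (K-2, K-3, K-4) plus ONE new row of the same family (K-7: the Hessian of `G̃₁`, all `z`, from ✓ `torusGreen_hessian_mul_dist_cube_le_of_eq` ⊕ ✓ `abs_torusGreen_le_of_eq`),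
on px4's free kernel `G_f` of ✓ `Prop7GreenKernelSiteFree.exists_green_site_split_free` at `c = 1` (`ΔG_f(x,·) = ½(G̃₁(· − x) − G̃₁(· − y₀))`, `Δ²G_f(x,·) = δ_x − δ_{y₀}`, `G_f(x,·) = ¼(G̃₂(· − x) − G̃₂(· − y₀))`).
THEOREMS ONLY (0 `def`, 0 `sorry`); `--supports stmt-QuantumFields-19200`, count-neutral.  YM₃ on T³ is a ladder rung (R3), not the Clay problem; nothing here claims the stub, the crux, d = 4 or the gap.

WHAT IS PROVED (ns `…Theorems.Prop7TransplantDipolePotential`; `laplace 1` = the positive flat Laplacian of `LatticeFieldCalculus`; `t := EK z − EK x`).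
* §1 conversion letters `abs_le_div_max_one_cube`, `mul_tdist_cube_le_of_mul_sqrt_cube`, `max_one_le_two_mul`, `div_pow_max_le_of_le_add_one` (pole shift by one site costs `2^p`), `EK_shift_sub`,
  `EK_unshift_sub`, `EK_sub_shift_right`, `laplace_one_sub`, `laplace_one_eq_sum_torusT` (dictionary to the `Σ_μ(2f − f(T_μ·) − f(T_μ⁻¹·))` letters of ✓p674125∕p675919).
* §2 ★★ `abs_green_hessian_EK_le` — (K-7) `|∇ᵢ⁺∇ⱼ⁻G̃₁(t)| ≤ c∕(1 ∨ tdist(z,x))³` for ALL `z, x, i, j`.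
* §3 ★★★ `exists_dipolePotential` — `∃ C ≥ 0, ∀ P (d = 3) k ≤ m+K, ∀ b μ, ∃ V : Site P 0 → ℝ`, the exact bi-Laplacian `Δ²V z = 𝟙[z = b+e_μ] − 𝟙[z = b]` and the five rows above.
HONEST SCOPE.  Flat lattice bookkeeping; the cutoff, the frame and the covariant numbers are the next files.

References: T. Bałaban, CMP 95 (1984) 17–40 [Balaban1984PropagatorsI] ((1.17) p.20, (1.21) p.21); CMP 99 (1985) 75–102 [Balaban1985RegularSpaces] ((1.36) p.82); G. Lawler, V. Limic,
*Random Walk: A Modern Introduction* (2010) Thm 4.3.1 [LawlerLimic2010].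
-/

set_option autoImplicit false

noncomputable section

open scoped BigOperators
open Finset

namespace Summit.QuantumFields.YangMills.Theorems.Prop7TransplantDipolePotential

open Literature.MathematicalPhysics.QuantumFieldTheory.Balaban1983to89
open LatticeFieldCalculus
open B5Prop11Plancherel (Tor fine unitVec)
open B5Eq117TorusCarriers (Mk EK EK_apply)
open B9TorusCalculus (torusT torusT_apply torusT_symm_apply)
open Literature.Probability.LatticeModels (torusGreen TorusSite latticeMomentum dispersion)
open Literature.MathematicalPhysics.QuantumFieldTheory.BalabanImbrieJaffe1984to88.BIJ85Thm711TorusTransport (EK_shift)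
open B3Taylor310LocalRemainder (tdist_comm tdist_self)
open Prop7CentreHarmonicDivDictionary (EK_unshift)
open Prop7GreenKernelSiteRows (torusGreen_hessian_mul_dist_cube_le_of_eq tdist_sq_le_card_mul_sum_sq EK_sub_eq_sub_shift_add)
open Prop7TorusGreen2PoleBounds (abs_torusGreen_le_of_eq)
open Prop7TorusGreenKernelRows (abs_green_grad_EK_le abs_green2_grad_EK_le abs_green2_hessian_EK_le)
open Prop7GreenKernelSiteFree (exists_green_site_split_free)
open Prop7PinnedKernelGeometry (tdist_le_tdist_shift_add_one tdist_le_tdist_unshift_add_one)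

/-! ## §1 Conversion letters -/

/-- the cubed version of ✓ `abs_le_div_max_one`: `|v| ≤ b` and `|v|·t³ ≤ a` give `|v| ≤ max a b ∕ (max 1 t)³`. [folklore] -/
theorem abs_le_div_max_one_cube {v a b : ℝ} {t : ℕ} (h0 : |v| ≤ b) (h3 : |v| * (t : ℝ) ^ 3 ≤ a) :
    |v| ≤ max a b / (max 1 (t : ℝ)) ^ 3 := by
  rw [le_div_iff₀ (by positivity)]
  rcases Nat.eq_zero_or_pos t with ht | ht
  · subst ht
    simp only [Nat.cast_zero]
    rw [max_eq_left (zero_le_one' ℝ), one_pow, mul_one]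
    exact h0.trans (le_max_right _ _)
  · have ht1 : (1 : ℝ) ≤ t := by exact_mod_cast ht
    rw [max_eq_right ht1]
    exact h3.trans (le_max_left _ _)

/-- the cubed version of ✓ `mul_tdist_le_of_mul_sqrt`: a row `|v|·(√Σz̃²)³ ≤ C` gives `|v|·tdist³ ≤ (√3)³·C` (`P.d = 3`). [folklore] -/
theorem mul_tdist_cube_le_of_mul_sqrt_cube {P : Params} (hd : P.d = 3) {k : ℕ} (hk : k ≤ P.m + P.K) (z x : Site P 0) {v C : ℝ}
    (h : |v| * Real.sqrt (∑ ν, ((((EK hk z - EK hk x) ν).valMinAbs : ℤ) : ℝ) ^ 2) ^ 3 ≤ C) :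
    |v| * ((Site.tdist z x : ℕ) : ℝ) ^ 3 ≤ Real.sqrt 3 ^ 3 * C := by
  have hsq := tdist_sq_le_card_mul_sum_sq hk z x
  have hd3 : (P.d : ℝ) = 3 := by exact_mod_cast hd
  rw [hd3] at hsq
  have ht : ((Site.tdist z x : ℕ) : ℝ) ≤ Real.sqrt 3 * Real.sqrt (∑ ν, ((((EK hk z - EK hk x) ν).valMinAbs : ℤ) : ℝ) ^ 2) := by
    rw [← Real.sqrt_mul (by norm_num), ← Real.sqrt_sq (Nat.cast_nonneg _)]
    exact Real.sqrt_le_sqrt (by exact_mod_cast hsq)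
  have hC : 0 ≤ C := le_trans (by positivity) h
  calc |v| * ((Site.tdist z x : ℕ) : ℝ) ^ 3 ≤ |v| * (Real.sqrt 3 * Real.sqrt (∑ ν, ((((EK hk z - EK hk x) ν).valMinAbs : ℤ) : ℝ) ^ 2)) ^ 3 :=
        mul_le_mul_of_nonneg_left (pow_le_pow_left₀ (Nat.cast_nonneg _) ht 3) (abs_nonneg _)
    _ = Real.sqrt 3 ^ 3 * (|v| * Real.sqrt (∑ ν, ((((EK hk z - EK hk x) ν).valMinAbs : ℤ) : ℝ) ^ 2) ^ 3) := by ring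
    _ ≤ Real.sqrt 3 ^ 3 * C := mul_le_mul_of_nonneg_left h (by positivity)

/-- pole shift by one site: `r ≤ s + 1 ⇒ 1 ∨ r ≤ 2·(1 ∨ s)`. [folklore] -/
theorem max_one_le_two_mul {r s : ℕ} (h : r ≤ s + 1) : max 1 (r : ℝ) ≤ 2 * max 1 (s : ℝ) := by
  have h1 : (1 : ℝ) ≤ max 1 (s : ℝ) := le_max_left _ _
  have h2 : (s : ℝ) ≤ max 1 (s : ℝ) := le_max_right _ _
  have h3 : (r : ℝ) ≤ s + 1 := by exact_mod_cast h
  exact max_le (by linarith) (by linarith)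

/-- pole shift by one site costs `2^p`: `r ≤ s + 1 ⇒ C∕(1∨s)^p ≤ 2^p·C∕(1∨r)^p` (`C ≥ 0`). [folklore] -/
theorem div_pow_max_le_of_le_add_one {r s : ℕ} (h : r ≤ s + 1) {C : ℝ} (hC : 0 ≤ C) (p : ℕ) :
    C / (max 1 (s : ℝ)) ^ p ≤ 2 ^ p * C / (max 1 (r : ℝ)) ^ p := by
  have hs : 0 < max 1 (s : ℝ) := lt_of_lt_of_le one_pos (le_max_left _ _)
  have hr : 0 < max 1 (r : ℝ) := lt_of_lt_of_le one_pos (le_max_left _ _)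
  rw [div_le_div_iff₀ (pow_pos hs p) (pow_pos hr p)]
  calc C * (max 1 (r : ℝ)) ^ p ≤ C * (2 * max 1 (s : ℝ)) ^ p := mul_le_mul_of_nonneg_left (pow_le_pow_left₀ hr.le (max_one_le_two_mul h) p) hC
    _ = 2 ^ p * C * (max 1 (s : ℝ)) ^ p := by ring

section EKletters

variable {P : Params} {k : ℕ}

/-- `EK (z + e_ν) − EK x = (EK z − EK x) + e_ν`. [cite: Balaban1984PropagatorsI, (1.17) p.20] -/
theorem EK_shift_sub (hk : k ≤ P.m + P.K) (z x : Site P 0) (ν : Fin P.d) :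
    EK hk (z.shift ν) - EK hk x = (EK hk z - EK hk x) + Pi.single ν 1 := by
  rw [EK_shift hk z ν]
  show EK hk z + Pi.single ν 1 - EK hk x = EK hk z - EK hk x + Pi.single ν 1
  abel

/-- `EK (z − e_ν) − EK x = (EK z − EK x) − e_ν`. [cite: Balaban1984PropagatorsI, (1.17) p.20] -/
theorem EK_unshift_sub (hk : k ≤ P.m + P.K) (z x : Site P 0) (ν : Fin P.d) :
    EK hk (z.unshift ν) - EK hk x = (EK hk z - EK hk x) - Pi.single ν 1 := by
  rw [EK_unshift hk z ν]
  show EK hk z - Pi.single ν 1 - EK hk x = EK hk z - EK hk x - Pi.single ν 1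
  abel

/-- `EK z − EK (x + e_μ) = (EK z − EK x) − e_μ`. [cite: Balaban1984PropagatorsI, (1.17) p.20] -/
theorem EK_sub_shift_right (hk : k ≤ P.m + P.K) (z x : Site P 0) (μ : Fin P.d) :
    EK hk z - EK hk (x.shift μ) = (EK hk z - EK hk x) - Pi.single μ 1 := by
  rw [EK_sub_eq_sub_shift_add hk z x μ]
  abel

/-- `Δ₁(u − v) = Δ₁u − Δ₁v` pointwise (real site functions). [cite: Balaban1984PropagatorsI, (1.21) p.21] -/
theorem laplace_one_sub (u v : Site P 0 → ℝ) (z : Site P 0) :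
    laplace 1 (fun w => u w - v w) z = laplace 1 u z - laplace 1 v z := by
  simp only [laplace, one_pow, one_smul, ← Finset.sum_sub_distrib]
  refine Finset.sum_congr rfl fun μ _ => ?_
  ring

/-- DICTIONARY: `laplace 1 f z = Σ_μ (2·f z − f(T_μ z) − f(T_μ⁻¹ z))` — `LatticeFieldCalculus.laplace` at `c = 1` IS the flat Laplacian letter of ✓p674125∕✓p675919 (`T = torusT P 0`).
[cite: Balaban1984PropagatorsI, (1.21) p.21] -/
theorem laplace_one_eq_sum_torusT (f : Site P 0 → ℝ) (z : Site P 0) :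
    laplace 1 f z = ∑ μ : Fin P.d, (2 * f z - f (torusT P 0 μ z) - f ((torusT P 0 μ).symm z)) := by
  simp only [laplace, one_pow, one_smul, torusT_apply, torusT_symm_apply, two_mul]

end EKletters

/-! ## §2 ★★ (K-7) the Hessian of `G̃₁`, all `z` -/

/-- ★★ **(K-7) the HESSIAN of `G̃₁`**: `|G̃₁(t+eᵢ) − G̃₁(t+eᵢ−eⱼ) − G̃₁(t) + G̃₁(t−eⱼ)| ≤ c ∕ (1 ∨ tdist(z,x))³`, `t = EK z − EK x`, for ALL `z, x, i, j` (`c` absolute; `P.d = 3`) — ✓ `torusGreen_hessian_mul_dist_cube_le_of_eq`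
off the pole (`·(√3)³`) ⊕ `4·C₀` at the pole by ✓ `abs_torusGreen_le_of_eq`. [cite: Balaban1985RegularSpaces, (1.36) p.82] -/
theorem abs_green_hessian_EK_le : ∃ c : ℝ, 0 ≤ c ∧ ∀ (P : Params) (_ : P.d = 3) (k : ℕ) (hk : k ≤ P.m + P.K) (x z : Site P 0) (i j : Fin P.d),
    |torusGreen (L := P.L ^ k * P.sitesPerDir k) ((EK hk z - EK hk x) + Pi.single i 1)
        - torusGreen (L := P.L ^ k * P.sitesPerDir k) ((EK hk z - EK hk x) + Pi.single i 1 - Pi.single j 1)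
        - torusGreen (L := P.L ^ k * P.sitesPerDir k) (EK hk z - EK hk x)
        + torusGreen (L := P.L ^ k * P.sitesPerDir k) ((EK hk z - EK hk x) - Pi.single j 1)|
      ≤ c / (max 1 ((Site.tdist z x : ℕ) : ℝ)) ^ 3 := by
  obtain ⟨C, hC⟩ := torusGreen_hessian_mul_dist_cube_le_of_eq
  obtain ⟨C₀, hC₀, h₀⟩ := abs_torusGreen_le_of_eq
  refine ⟨max (Real.sqrt 3 ^ 3 * max C 0) (4 * C₀), le_max_of_le_right (by positivity), ?_⟩
  intro P hd k hk x z i j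
  haveI : NeZero (P.L ^ k * P.sitesPerDir k) := ⟨mul_ne_zero (pow_ne_zero _ P.L_pos.ne') (P.sitesPerDir_ne_zero k)⟩
  set t : TorusSite P.d (P.L ^ k * P.sitesPerDir k) := EK hk z - EK hk x with ht
  have hpole : |torusGreen (t + Pi.single i 1) - torusGreen (t + Pi.single i 1 - Pi.single j 1) - torusGreen t + torusGreen (t - Pi.single j 1)| ≤ 4 * C₀ := by
    have e1 := h₀ hd _ (t + Pi.single i 1)
    have e2 := h₀ hd _ (t + Pi.single i 1 - Pi.single j 1)
    have e3 := h₀ hd _ t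
    have e4 := h₀ hd _ (t - Pi.single j 1)
    have hA : |torusGreen (t + Pi.single i 1) - torusGreen (t + Pi.single i 1 - Pi.single j 1) - torusGreen t + torusGreen (t - Pi.single j 1)|
        ≤ |torusGreen (t + Pi.single i 1) - torusGreen (t + Pi.single i 1 - Pi.single j 1) - torusGreen t| + |torusGreen (t - Pi.single j 1)| := abs_add_le _ _
    have hB : |torusGreen (t + Pi.single i 1) - torusGreen (t + Pi.single i 1 - Pi.single j 1) - torusGreen t|
        ≤ |torusGreen (t + Pi.single i 1) - torusGreen (t + Pi.single i 1 - Pi.single j 1)| + |torusGreen t| := abs_sub _ _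
    have hC' : |torusGreen (t + Pi.single i 1) - torusGreen (t + Pi.single i 1 - Pi.single j 1)|
        ≤ |torusGreen (t + Pi.single i 1)| + |torusGreen (t + Pi.single i 1 - Pi.single j 1)| := abs_sub _ _
    linarith
  refine abs_le_div_max_one_cube hpole ?_
  by_cases hzx : z = x
  · subst hzx
    rw [tdist_self]; simp only [Nat.cast_zero]; rw [zero_pow three_ne_zero, mul_zero]; positivity
  · have htne : t ≠ 0 := fun h => hzx ((EK hk).injective (sub_eq_zero.1 h))
    have h1 := (hC hd (P.L ^ k * P.sitesPerDir k) i j t htne).trans (le_max_left C 0)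
    exact mul_tdist_cube_le_of_mul_sqrt_cube hd hk z x h1

/-! ## §3 ★★★ The dipole potential and its rows -/

/-- ★★★ **THE FLAT TORUS DIPOLE POTENTIAL WITH ITS RADIAL ROWS** (`d = 3`, ONE absolute `C`): for every bond `(b, b + e_μ)` of `Site P 0` and every `k ≤ m + K` there is `V : Site P 0 → ℝ` (namely
`V = G_f(b+e_μ, ·) − G_f(b, ·)` for px4's free biharmonic kernel `G_f` at `c = 1`) with (i) `Δ²V = 𝟙_{b+e_μ} − 𝟙_b` EXACTLY on the torus; (ii) `|V z| ≤ C`; (iii) `|V(z ± e_ν) − V z| ≤ C∕(1∨r)`; (iv) `|ΔV z| ≤ C∕(1∨r)²`;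
(v) `|ΔV(z ± e_ν) − ΔV z| ≤ C∕(1∨r)³`, `r = tdist(z, b)` — the rows (K-3), (K-4), (K-2), (K-7) read on the dipole, pole shifts `b + e_μ → b`, `z − e_ν → z` at cost `2^p`.
[cite: Balaban1984PropagatorsI, (1.17) p.20, (1.21) p.21; Balaban1985RegularSpaces, (1.36) p.82] -/
theorem exists_dipolePotential : ∃ C : ℝ, 0 ≤ C ∧ ∀ (P : Params) (_ : P.d = 3) (k : ℕ) (_ : k ≤ P.m + P.K) (b : Site P 0) (μ : Fin P.d),
    ∃ V : Site P 0 → ℝ,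
      (∀ z, laplace 1 (laplace 1 V) z = (if z = b.shift μ then (1 : ℝ) else 0) - (if z = b then (1 : ℝ) else 0)) ∧
      (∀ z, |V z| ≤ C) ∧
      (∀ z ν, |V (z.shift ν) - V z| ≤ C / max 1 ((Site.tdist z b : ℕ) : ℝ)) ∧
      (∀ z ν, |V (z.unshift ν) - V z| ≤ C / max 1 ((Site.tdist z b : ℕ) : ℝ)) ∧
      (∀ z, |laplace 1 V z| ≤ C / (max 1 ((Site.tdist z b : ℕ) : ℝ)) ^ 2) ∧
      (∀ z ν, |laplace 1 V (z.shift ν) - laplace 1 V z| ≤ C / (max 1 ((Site.tdist z b : ℕ) : ℝ)) ^ 3) ∧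
      (∀ z ν, |laplace 1 V (z.unshift ν) - laplace 1 V z| ≤ C / (max 1 ((Site.tdist z b : ℕ) : ℝ)) ^ 3) := by
  obtain ⟨c₂, hc₂, K2⟩ := abs_green_grad_EK_le
  obtain ⟨c₃, hc₃, K3⟩ := abs_green2_grad_EK_le
  obtain ⟨c₄, hc₄, K4⟩ := abs_green2_hessian_EK_le
  obtain ⟨c₇, hc₇, K7⟩ := abs_green_hessian_EK_le
  -- one constant dominating every row (pole shifts cost `2`, `4`, `8`)
  refine ⟨c₃ / 4 + 2 * (c₄ / 4) + 4 * (c₂ / 2) + 8 * (c₇ / 2), by positivity, ?_⟩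
  intro P hd k hk b μ
  classical
  haveI : NeZero (P.L ^ k * P.sitesPerDir k) := ⟨mul_ne_zero (pow_ne_zero _ P.L_pos.ne') (P.sitesPerDir_ne_zero k)⟩
  obtain ⟨Gf, Uf, G, -, -, -, -, hLf, hLLf, hGf, -⟩ := exists_green_site_split_free (P := P) (k := k) hk (c := (1 : ℝ)) one_ne_zero (V := ℝ)
  -- the explicit biharmonic torus Green function of record
  set G₂ : TorusSite P.d (P.L ^ k * P.sitesPerDir k) → ℝ := fun t =>
    (∑ q ∈ (univ : Finset (TorusSite P.d (P.L ^ k * P.sitesPerDir k))).erase 0,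
      Real.cos (∑ i, latticeMomentum (P.L ^ k * P.sitesPerDir k) q i * ((t i).val : ℝ))
        / dispersion (latticeMomentum (P.L ^ k * P.sitesPerDir k) q) ^ 2)
      / (((P.L ^ k * P.sitesPerDir k : ℕ) : ℝ)) ^ P.d with hG₂def
  have hG₂ : ∀ t : TorusSite P.d (P.L ^ k * P.sitesPerDir k), G₂ t
      = (∑ q ∈ (univ : Finset (TorusSite P.d (P.L ^ k * P.sitesPerDir k))).erase 0,
        Real.cos (∑ i, latticeMomentum (P.L ^ k * P.sitesPerDir k) q i * ((t i).val : ℝ))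
          / dispersion (latticeMomentum (P.L ^ k * P.sitesPerDir k) q) ^ 2)
        / (((P.L ^ k * P.sitesPerDir k : ℕ) : ℝ)) ^ P.d := fun t => rfl
  have hV2 := hGf G₂ hG₂
  -- pole shifts
  have hsb : ∀ z : Site P 0, Site.tdist z b ≤ Site.tdist z (b.shift μ) + 1 := fun z => by
    rw [tdist_comm z b, tdist_comm z (b.shift μ)]; exact tdist_le_tdist_shift_add_one b z μ
  have hsz : ∀ (z : Site P 0) (ν : Fin P.d), Site.tdist z b ≤ Site.tdist (z.unshift ν) b + 1 := fun z ν => tdist_le_tdist_unshift_add_one z b ν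
  -- nonnegativity of the partial constants
  have hA0 : 0 ≤ c₃ / 4 := by positivity
  have hB0 : 0 ≤ c₄ / 4 := by positivity
  have hC0 : 0 ≤ c₂ / 2 := by positivity
  have hD0 : 0 ≤ c₇ / 2 := by positivity
  have hmax1 : ∀ z : Site P 0, (1 : ℝ) ≤ max 1 ((Site.tdist z b : ℕ) : ℝ) := fun z => le_max_left _ _
  -- (iii) forward, at every site, with constant `c₄/4`
  have hfwd : ∀ (z : Site P 0) (ν : Fin P.d), |(Gf (b.shift μ) (z.shift ν) - Gf b (z.shift ν)) - (Gf (b.shift μ) z - Gf b z)| ≤ c₄ / 4 / max 1 ((Site.tdist z b : ℕ) : ℝ) := by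
    intro z ν
    have e : (Gf (b.shift μ) (z.shift ν) - Gf b (z.shift ν)) - (Gf (b.shift μ) z - Gf b z)
        = -(4 : ℝ)⁻¹ * (G₂ ((EK hk z - EK hk b) + Pi.single ν 1) - G₂ ((EK hk z - EK hk b) + Pi.single ν 1 - Pi.single μ 1)
            - G₂ (EK hk z - EK hk b) + G₂ ((EK hk z - EK hk b) - Pi.single μ 1)) := by
      rw [hV2 (b.shift μ) (z.shift ν), hV2 b (z.shift ν), hV2 (b.shift μ) z, hV2 b z, EK_sub_shift_right hk (z.shift ν) b μ, EK_shift_sub hk z b ν,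
        EK_sub_shift_right hk z b μ]
      ring
    rw [e, abs_mul, abs_neg, abs_inv, abs_of_pos (by norm_num : (0 : ℝ) < 4)]
    have h := K4 P hd k hk G₂ hG₂ b z ν μ
    calc (4 : ℝ)⁻¹ * _ ≤ (4 : ℝ)⁻¹ * (c₄ / max 1 ((Site.tdist z b : ℕ) : ℝ)) := mul_le_mul_of_nonneg_left h (by norm_num)
      _ = c₄ / 4 / max 1 ((Site.tdist z b : ℕ) : ℝ) := by ring
  -- (v) forward, at every site, with constant `c₇/2`
  have hLfwd : ∀ (z : Site P 0) (ν : Fin P.d), |laplace 1 (fun w => Gf (b.shift μ) w - Gf b w) (z.shift ν) - laplace 1 (fun w => Gf (b.shift μ) w - Gf b w) z|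
      ≤ c₇ / 2 / (max 1 ((Site.tdist z b : ℕ) : ℝ)) ^ 3 := by
    intro z ν
    have e : laplace 1 (fun w => Gf (b.shift μ) w - Gf b w) (z.shift ν) - laplace 1 (fun w => Gf (b.shift μ) w - Gf b w) z
        = -(2 : ℝ)⁻¹ * (torusGreen (L := P.L ^ k * P.sitesPerDir k) ((EK hk z - EK hk b) + Pi.single ν 1)
            - torusGreen (L := P.L ^ k * P.sitesPerDir k) ((EK hk z - EK hk b) + Pi.single ν 1 - Pi.single μ 1)
            - torusGreen (L := P.L ^ k * P.sitesPerDir k) (EK hk z - EK hk b)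
            + torusGreen (L := P.L ^ k * P.sitesPerDir k) ((EK hk z - EK hk b) - Pi.single μ 1)) := by
      rw [laplace_one_sub, laplace_one_sub, hLf (b.shift μ) (z.shift ν), hLf b (z.shift ν), hLf (b.shift μ) z, hLf b z, EK_sub_shift_right hk (z.shift ν) b μ,
        EK_shift_sub hk z b ν, EK_sub_shift_right hk z b μ]
      ring
    rw [e, abs_mul, abs_neg, abs_inv, abs_of_pos (by norm_num : (0 : ℝ) < 2)]
    have h := K7 P hd k hk b z ν μ
    calc (2 : ℝ)⁻¹ * _ ≤ (2 : ℝ)⁻¹ * (c₇ / (max 1 ((Site.tdist z b : ℕ) : ℝ)) ^ 3) := mul_le_mul_of_nonneg_left h (by norm_num)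
      _ = c₇ / 2 / (max 1 ((Site.tdist z b : ℕ) : ℝ)) ^ 3 := by ring
  refine ⟨fun z => Gf (b.shift μ) z - Gf b z, ?_, ?_, ?_, ?_, ?_, ?_, ?_⟩
  · -- (i) the exact bi-Laplacian
    intro z
    have e1 : laplace 1 (fun w => Gf (b.shift μ) w - Gf b w) = fun w => laplace 1 (Gf (b.shift μ)) w - laplace 1 (Gf b) w :=
      funext fun w => laplace_one_sub _ _ w
    rw [e1, laplace_one_sub, hLLf, hLLf]
    ring
  · -- (ii) `|V| ≤ C`: (K-3) at the pole `b + e_μ`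
    intro z
    show |Gf (b.shift μ) z - Gf b z| ≤ _
    have e : Gf (b.shift μ) z - Gf b z = -(4 : ℝ)⁻¹ * (G₂ ((EK hk z - EK hk (b.shift μ)) + Pi.single μ 1) - G₂ (EK hk z - EK hk (b.shift μ))) := by
      rw [hV2 (b.shift μ) z, hV2 b z, EK_sub_eq_sub_shift_add hk z b μ]
      ring
    rw [e, abs_mul, abs_neg, abs_inv, abs_of_pos (by norm_num : (0 : ℝ) < 4)]
    have h := K3 P hd k hk G₂ hG₂ (b.shift μ) z μ
    have h1 : (4 : ℝ)⁻¹ * |G₂ ((EK hk z - EK hk (b.shift μ)) + Pi.single μ 1) - G₂ (EK hk z - EK hk (b.shift μ))| ≤ c₃ / 4 := by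
      calc _ ≤ (4 : ℝ)⁻¹ * c₃ := mul_le_mul_of_nonneg_left h (by norm_num)
        _ = c₃ / 4 := by ring
    linarith
  · -- (iii) forward
    intro z ν
    refine (hfwd z ν).trans ?_
    rw [div_le_div_iff_of_pos_right (lt_of_lt_of_le one_pos (hmax1 z))]
    linarith
  · -- (iii) backward: forward at `z − e_ν`, pole shift
    intro z ν
    have h := hfwd (z.unshift ν) ν
    rw [B5Display136Torus.shift_unshift] at h
    rw [abs_sub_comm] at h
    have h2 := div_pow_max_le_of_le_add_one (hsz z ν) hB0 1
    simp only [pow_one] at h2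
    refine h.trans (h2.trans ?_)
    rw [div_le_div_iff_of_pos_right (lt_of_lt_of_le one_pos (hmax1 z))]
    linarith
  · -- (iv) `|ΔV| ≤ C/(1∨r)²`: (K-2) at the pole `b + e_μ`, pole shift
    intro z
    have e : laplace 1 (fun w => Gf (b.shift μ) w - Gf b w) z
        = -(2 : ℝ)⁻¹ * (torusGreen (L := P.L ^ k * P.sitesPerDir k) ((EK hk z - EK hk (b.shift μ)) + Pi.single μ 1)
            - torusGreen (L := P.L ^ k * P.sitesPerDir k) (EK hk z - EK hk (b.shift μ))) := by
      rw [laplace_one_sub, hLf (b.shift μ) z, hLf b z, EK_sub_eq_sub_shift_add hk z b μ]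
      ring
    rw [e, abs_mul, abs_neg, abs_inv, abs_of_pos (by norm_num : (0 : ℝ) < 2)]
    have h := K2 P hd k hk (b.shift μ) z μ
    have h1 : (2 : ℝ)⁻¹ * |torusGreen (L := P.L ^ k * P.sitesPerDir k) ((EK hk z - EK hk (b.shift μ)) + Pi.single μ 1)
        - torusGreen (L := P.L ^ k * P.sitesPerDir k) (EK hk z - EK hk (b.shift μ))| ≤ c₂ / 2 / (max 1 ((Site.tdist z (b.shift μ) : ℕ) : ℝ)) ^ 2 := by
      calc _ ≤ (2 : ℝ)⁻¹ * (c₂ / (max 1 ((Site.tdist z (b.shift μ) : ℕ) : ℝ)) ^ 2) := mul_le_mul_of_nonneg_left h (by norm_num)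
        _ = _ := by ring
    refine h1.trans ((div_pow_max_le_of_le_add_one (hsb z) hC0 2).trans ?_)
    rw [div_le_div_iff_of_pos_right (pow_pos (lt_of_lt_of_le one_pos (hmax1 z)) 2)]
    norm_num
    linarith
  · -- (v) forward
    intro z ν
    refine (hLfwd z ν).trans ?_
    rw [div_le_div_iff_of_pos_right (pow_pos (lt_of_lt_of_le one_pos (hmax1 z)) 3)]
    linarith
  · -- (v) backward
    intro z ν
    have h := hLfwd (z.unshift ν) ν
    rw [B5Display136Torus.shift_unshift] at h
    rw [abs_sub_comm] at h
    refine h.trans ((div_pow_max_le_of_le_add_one (hsz z ν) hD0 3).trans ?_)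
    rw [div_le_div_iff_of_pos_right (pow_pos (lt_of_lt_of_le one_pos (hmax1 z)) 3)]
    norm_num
    linarith

end Summit.QuantumFields.YangMills.Theorems.Prop7TransplantDipolePotential

end
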